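import Literature.MathematicalPhysics.QuantumLattice.LiebWuBetheAnsatz
import Literature.Topology.Euclidean.BrouwerFixedPoint
import HarnessLib

/-!
# Goldbaum's existence theorem for the Lieb–Wu equations (F1 of `LiebWuBetheAnsatz`, proved)

Family `hubbard` (trunk T-QLATTICE), statement hubbard.S10 (`Literature.MathematicalPhysics.QuantumLattice.lieb_wu`). This file
DISCHARGES the named fact F1 = `Literature.MathematicalPhysics.QuantumLattice.goldbaum_liebWuGroundRoots_exists` of
`Literature/MathematicalPhysics/QuantumLattice/LiebWuBetheAnsatz.lean`:

* `Literature.Hubbard.goldbaum_liebWuGroundRoots_exists_holds : goldbaum_liebWuGroundRoots_exists` —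
  for every `U > 0` and every `m`, the Lieb–Wu equations on the ring of `N_a = 4m + 2` sites at
  half filling (`N = 4m + 2` electrons, `M = 2m + 1` down spins) with the ground-state quantum
  numbers `I_j = j - (N+1)/2`, `J_α = α - (M+1)/2` have a real solution with
  `-π ≤ k_1 < ⋯ < k_N ≤ π`, `Λ_1 < ⋯ < Λ_M` (`IsLiebWuGroundRoots U m k Λ`). This is the
  half-filled case of Goldbaum, CMP 258 (2005) 317, Theorem 1.1 (stated there for all `N` even,
  `M` odd, together with a continuous curve of solutions in `U`, which is not needed here).

Nothing in `LiebWuBetheAnsatz.lean` is restated or changed; after this file the remaining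
undischarged hypotheses of `lieb_wu_of_roots'` are F2′, F3 and F5b.

## The proof (after Goldbaum 2005, §2)

Goldbaum, §2.1: "Because of the symmetry of the coefficients `I_j` and `J_α`, we can look for
symmetric solutions of the form `k_j = -k_{N-j+1}`, and `Λ_α = -Λ_{M-α+1}`", so that the unknowns
are the positive halves `p = (k_{N/2+1}, …, k_N) ∈ ℝ^{2m+1}` and `q = (Λ_{(M+3)/2}, …, Λ_M) ∈ ℝ^m`
(`kOfHalf`, `lamOfHalf` rebuild the antisymmetric vectors; `Λ_{(M+1)/2} = 0`). On the box
`Ω = [0, π]^{2m+1} × [0, C]^m` (Goldbaum's Lemma 2.1 domain, with an explicit a-priori bound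
`C = 1 + (U/4) tan((4m+1)π/(8m+4))` playing the role of his constant `C_{N,U}`) we consider the
continuous self-map `goldbaumMap` whose components are clamped running maxima (`runMax`; Goldbaum
"artificially introduced the maximum in the definition of `k'`", §2.3) of

* the momentum update `k'_j = (2π I_j + Σ_β θ(2 sin k_j - 2Λ_β))/N_a` (`kStep`, §2.1), and
* the relaxed rapidity update `Λ_α + (2π J_α - Σ_β θ(Λ_α - Λ_β) - Σ_j θ(2 sin k_j - 2Λ_α))`
  (`lamStep`). DEVIATION: Goldbaum defines `Λ'_α` implicitly as the unique solution of the second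
  Lieb–Wu equation (his eq. (2.1), "well defined since the left side of (2.1) is continuous and
  strictly increasing"); the explicit relaxation has the same fixed points and avoids the implicit
  function. The held text of the paper (S2ORC) carries no displayed formulas, so the constants and
  the map are reconstructed from the prose, not transcribed.

Brouwer's fixed point theorem (§2.2; here `exists_fixedPoint_of_mapsTo_box`, reduced to
`Literature.Topology.Euclidean.Brouwer.exists_fixedPoint_closedBall` by rescaling and the coordinatewise retraction onto
the box) gives a fixed point. At a fixed point the clamps are inactive and the coordinates are
strictly increasing and positive (§2.3, `runMax_fixedPoint`: the floor at `0` is inactive because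
the updates are `> 0` there by antisymmetry, the cap is inactive because `k'_j ≤ (4m+1)π/(4m+2)`
at `k_j = π` and because of the a-priori bound `lamStep_cap` at `Λ_α = C`, and consecutive equal
coordinates would have updates differing by `2π/N_a`, resp. `2π`), so the symmetric extensions
solve the Lieb–Wu equations (reflection covariance `liebWu_fst_rev`, `liebWu_snd_rev`), are
strictly increasing (`strictMono_kOfHalf`, `strictMono_lamOfHalf`) and `k ∈ [-π, π]`.

## Design notes

* All auxiliary notions live in the namespace `Literature.Hubbard.LiebWuGoldbaum`; only the discharge
  `Literature.MathematicalPhysics.QuantumLattice.goldbaum_liebWuGroundRoots_exists_holds` is at the level of the fact.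
* The box is indexed by `Fin (2m+1) ⊕ Fin m`; `pAt`/`qAt` read coordinates by natural-number
  index (so that the running maxima are plain `ℕ`-recursions).
* Mathlib has no Brouwer fixed point theorem (the Literature file
  `Topology/Euclidean/BrouwerFixedPoint.lean` provides it for the Euclidean unit ball); Mathlib's
  `Real.arctan_mono`, `Real.arctan_tan`, `Fin.strictMono_iff_lt_succ`, `Fin.revPerm` are used.

## Sources

* P. S. Goldbaum, *Existence of solutions to the Bethe ansatz equations for the 1D Hubbard model:
  finite lattice and thermodynamic limit*, CMP 258 (2005) 317–337 = arXiv:cond-mat/0403736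
  (held, text without formulas; key `Goldbaum2005`): Theorem 1.1; §2.1 (symmetric solutions, the
  map, eq. (2.1), the constant `C_{N,U}`); §2.2 (Lemma 2.1, Brouwer); §2.3 (the fixed point solves
  the equations).
* E. H. Lieb, F. Y. Wu, Physica A 321 (2003) 1–27 = arXiv:cond-mat/0207529 (held; key
  `LiebWuPhysicaA2003`): §3 (the Lieb–Wu equations, `θ`, the ground-state `I_j`, `J_α`).
-/

open Finset Real Filter Topology Metric Set

namespace Literature.MathematicalPhysics.QuantumLattice

namespace LiebWuGoldbaum

/-! ### Brouwer's fixed point theorem on a box -/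

section Brouwer

variable {ι : Type*} [Fintype ι]

/-- The Euclidean norm of a vector with coordinates bounded by `M ≥ 0` is at most `√(card ι) · M`.
[folklore] -/
theorem norm_le_of_forall_abs_le (x : EuclideanSpace ℝ ι) {M : ℝ} (hM : 0 ≤ M)
    (h : ∀ i, |x i| ≤ M) : ‖x‖ ≤ Real.sqrt (Fintype.card ι) * M := by
  rw [EuclideanSpace.norm_eq]
  calc Real.sqrt (∑ i, ‖x i‖ ^ 2) ≤ Real.sqrt (∑ _i : ι, M ^ 2) := by
        gcongr with i
        rw [Real.norm_eq_abs]
        exact h i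
    _ = Real.sqrt (Fintype.card ι) * M := by
        rw [Finset.sum_const, Finset.card_univ, nsmul_eq_mul, Real.sqrt_mul (Nat.cast_nonneg _),
          Real.sqrt_sq hM]

/-- **Brouwer's fixed point theorem on a box.** A continuous map of `ι → ℝ` (`ι` finite) sending
the box `{x | a ≤ x ≤ b}` (`a ≤ b`) into itself has a fixed point in the box. Reduced to
`Literature.Topology.Euclidean.Brouwer.exists_fixedPoint_closedBall` (the closed unit ball of `EuclideanSpace ℝ ι`) by
rescaling and composing with the coordinatewise retraction `x ↦ max a (min b x)` onto the box.
[folklore] -/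
theorem exists_fixedPoint_of_mapsTo_box {a b : ι → ℝ} (hab : a ≤ b) {f : (ι → ℝ) → (ι → ℝ)}
    (hf : Continuous f) (hmaps : ∀ x, a ≤ x → x ≤ b → a ≤ f x ∧ f x ≤ b) :
    ∃ x, a ≤ x ∧ x ≤ b ∧ f x = x := by
  classical
  -- the retraction onto the box
  set clamp : (ι → ℝ) → (ι → ℝ) := fun x i => max (a i) (min (b i) (x i)) with hclamp
  have hclamp_cont : Continuous clamp :=
    continuous_pi fun i => continuous_const.max (continuous_const.min (continuous_apply i))
  have hclamp_mem : ∀ x, a ≤ clamp x ∧ clamp x ≤ b := fun x =>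
    ⟨fun i => le_max_left _ _, fun i => max_le (hab i) (min_le_left _ _)⟩
  have hclamp_id : ∀ x, a ≤ x → x ≤ b → clamp x = x := fun x ha hb => by
    ext i
    simp [hclamp, min_eq_right (hb i), max_eq_right (ha i)]
  -- a radius containing the box
  set M : ℝ := ∑ i, (|a i| + |b i|) with hM
  have hM0 : 0 ≤ M := Finset.sum_nonneg fun i _ => by positivity
  have hcoord : ∀ x, a ≤ x → x ≤ b → ∀ i, |x i| ≤ M := by
    intro x ha hb i
    have h1 : |x i| ≤ |a i| + |b i| := by
      rw [abs_le]
      constructor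
      · have := ha i; have := neg_abs_le (a i); have := abs_nonneg (b i); linarith
      · have := hb i; have := le_abs_self (b i); have := abs_nonneg (a i); linarith
    exact h1.trans (Finset.single_le_sum (f := fun i => |a i| + |b i|)
      (fun i _ => by positivity) (Finset.mem_univ i))
  set R : ℝ := Real.sqrt (Fintype.card ι) * M + 1 with hR
  have hR0 : 0 < R := by positivity
  have hbox_norm : ∀ x, a ≤ x → x ≤ b → ‖(WithLp.toLp 2 x : EuclideanSpace ℝ ι)‖ ≤ R := by
    intro x ha hb
    have := norm_le_of_forall_abs_le (WithLp.toLp 2 x : EuclideanSpace ℝ ι) hM0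
      (fun i => by simpa using hcoord x ha hb i)
    linarith
  -- the conjugated self-map of the unit ball
  set g : EuclideanSpace ℝ ι → EuclideanSpace ℝ ι :=
    fun y => WithLp.toLp 2 (R⁻¹ • f (clamp (R • (WithLp.ofLp y)))) with hg
  have hg_cont : Continuous g := by
    have h1 : Continuous fun y : EuclideanSpace ℝ ι => R • (WithLp.ofLp y : ι → ℝ) :=
      (PiLp.continuous_ofLp 2 (fun _ : ι => ℝ)).const_smul R
    have h2 : Continuous fun y : EuclideanSpace ℝ ι => R⁻¹ • f (clamp (R • (WithLp.ofLp y))) :=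
      (hf.comp (hclamp_cont.comp h1)).const_smul R⁻¹
    exact (PiLp.continuous_toLp 2 (fun _ : ι => ℝ)).comp h2
  have hg_maps : MapsTo g (closedBall 0 1) (closedBall 0 1) := by
    intro y _
    rw [mem_closedBall_zero_iff, hg]
    dsimp only
    obtain ⟨ha, hb⟩ := hmaps _ (hclamp_mem (R • WithLp.ofLp y)).1 (hclamp_mem (R • WithLp.ofLp y)).2
    have := hbox_norm _ ha hb
    rw [WithLp.toLp_smul, norm_smul, norm_inv, Real.norm_of_nonneg hR0.le,
      inv_mul_le_iff₀ hR0, mul_one]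
    exact this
  obtain ⟨y, -, hy⟩ := Literature.Topology.Euclidean.Brouwer.exists_fixedPoint_closedBall hg_cont.continuousOn hg_maps
  -- unwind
  set x : ι → ℝ := R • WithLp.ofLp y with hx
  have hfx : f (clamp x) = x := by
    have h1 : WithLp.ofLp (g y) = WithLp.ofLp y := by rw [hy]
    rw [hg] at h1
    dsimp only at h1
    rw [WithLp.ofLp_toLp] at h1
    have h2 : R • (R⁻¹ • f (clamp (R • WithLp.ofLp y))) = R • WithLp.ofLp y := by rw [h1]
    rwa [smul_smul, mul_inv_cancel₀ hR0.ne', one_smul] at h2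
  obtain ⟨ha, hb⟩ := hmaps _ (hclamp_mem x).1 (hclamp_mem x).2
  rw [hfx] at ha hb
  refine ⟨x, ha, hb, ?_⟩
  rw [hclamp_id x ha hb] at hfx
  exact hfx

end Brouwer

/-! ### Running maxima and their fixed points -/

/-- The clamped running maximum `r_j = min top (max r_{j-1} c_j)`, `r_{-1} = 0`, of a real
sequence `c` (Goldbaum's device "`k'_j = max …`" forcing the image of his map to be ordered).
[cite: Goldbaum2005, §2.1] -/
noncomputable def runMax (top : ℝ) (c : ℕ → ℝ) : ℕ → ℝ
  | 0 => min top (max 0 (c 0))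
  | j + 1 => min top (max (runMax top c j) (c (j + 1)))

/-- The first running maximum. [folklore] -/
@[simp] theorem runMax_zero (top : ℝ) (c : ℕ → ℝ) : runMax top c 0 = min top (max 0 (c 0)) := rfl

/-- The recursion of the running maxima. [folklore] -/
@[simp] theorem runMax_succ (top : ℝ) (c : ℕ → ℝ) (j : ℕ) :
    runMax top c (j + 1) = min top (max (runMax top c j) (c (j + 1))) := rfl

/-- Running maxima are capped by `top`. [folklore] -/
theorem runMax_le (top : ℝ) (c : ℕ → ℝ) (j : ℕ) : runMax top c j ≤ top := by
  cases j <;> exact min_le_left _ _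

/-- Running maxima are nonnegative (for `top ≥ 0`). [folklore] -/
theorem runMax_nonneg {top : ℝ} (htop : 0 ≤ top) (c : ℕ → ℝ) (j : ℕ) : 0 ≤ runMax top c j := by
  induction j with
  | zero => exact le_min htop (le_max_left _ _)
  | succ j ih => exact le_min htop (ih.trans (le_max_left _ _))

/-- The running maximum is continuous in the sequence. [folklore] -/
theorem continuous_runMax {X : Type*} [TopologicalSpace X] (top : ℝ) {c : X → ℕ → ℝ}
    (hc : ∀ j, Continuous fun x => c x j) (j : ℕ) : Continuous fun x => runMax top (c x) j := by
  induction j with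
  | zero => simpa using continuous_const.min (continuous_const.max (hc 0))
  | succ j ih => simpa using continuous_const.min (ih.max (hc (j + 1)))

/-- One step of the fixed-point analysis of a clamped running maximum: if
`P = min top (max prev c)` with `prev ≤ top`, the cap is inactive (`P = top → c ≤ top`) and the
floor is inactive (`P = prev → prev < c`), then `P = c` and `prev < P`. [cite: Goldbaum2005, §2.3] -/
theorem eq_and_lt_of_eq_min_max {top prev c P : ℝ} (hprev : prev ≤ top)
    (hP : P = min top (max prev c)) (h1 : P = top → c ≤ top) (h2 : P = prev → prev < c) :
    P = c ∧ prev < P := by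
  have hge : prev ≤ P := by rw [hP]; exact le_min hprev (le_max_left _ _)
  have hne : P ≠ prev := by
    intro he
    have hc := h2 he
    have hP' : P = min top c := by rw [hP, max_eq_right hc.le]
    rcases le_or_gt c top with hct | hct
    · rw [min_eq_right hct] at hP'
      rw [hP'] at he
      exact hc.ne' he
    · have hPt : P = top := by rw [hP', min_eq_left hct.le]
      exact absurd (h1 hPt) (not_le.mpr hct)
  have hlt : prev < P := lt_of_le_of_ne hge (Ne.symm hne)
  refine ⟨?_, hlt⟩
  rcases le_or_gt c prev with hc | hc
  · rw [max_eq_left hc, min_eq_right hprev] at hP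
    exact absurd hP hne
  · rw [max_eq_right hc.le] at hP
    rcases le_or_gt c top with hct | hct
    · rw [hP, min_eq_right hct]
    · have hPt : P = top := by rw [hP, min_eq_left hct.le]
      exact absurd (h1 hPt) (not_le.mpr hct)

/-- **Fixed points of a clamped running maximum solve the unclamped equations and are strictly
ordered** (Goldbaum 2005, §2.3: "since we artificially introduced the maximum in the definition
of `k'`, we need to show that the fixed point is indeed a solution to the original equations").
If `p_j = runMax top c j` for `j < n`, the cap is never active (`p_j = top → c_j ≤ top`),
consecutive coincidences shift `c` by `δ > 0` (`p_{j+1} = p_j → c_{j+1} = c_j + δ`) and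
`p_0 = 0 → 0 < c_0`, then `p_j = c_j` for all `j < n`, `p` is strictly increasing and `p_0 > 0`.
[cite: Goldbaum2005, §2.3] -/
theorem runMax_fixedPoint {top δ : ℝ} (htop : 0 < top) (hδ : 0 < δ) {c p : ℕ → ℝ} {n : ℕ}
    (hp : ∀ j < n, p j = runMax top c j) (hA1 : ∀ j < n, p j = top → c j ≤ top)
    (hA2 : ∀ j, j + 1 < n → p (j + 1) = p j → c (j + 1) = c j + δ)
    (hA3 : 0 < n → p 0 = 0 → 0 < c 0) :
    (∀ j < n, p j = c j) ∧ (∀ j, j + 1 < n → p j < p (j + 1)) ∧ (0 < n → 0 < p 0) := by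
  have main : ∀ j, j < n →
      p j = c j ∧ (j = 0 → 0 < p 0) ∧ (∀ i, j = i + 1 → p i < p j) := by
    intro j
    induction j with
    | zero =>
      intro hn
      have h := eq_and_lt_of_eq_min_max (prev := 0) htop.le (by rw [hp 0 hn, runMax_zero])
        (hA1 0 hn) (hA3 hn)
      exact ⟨h.1, fun _ => h.2, fun i hi => absurd hi (by omega)⟩
    | succ j ih =>
      intro hn
      have hjn : j < n := by omega
      have hpj := (ih hjn).1
      have h := eq_and_lt_of_eq_min_max (prev := p j) (top := top) (c := c (j + 1))
        (P := p (j + 1)) (by rw [hp j hjn]; exact runMax_le _ _ _)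
        (by rw [hp (j + 1) hn, runMax_succ, ← hp j hjn]) (hA1 (j + 1) hn)
        (fun he => by rw [hA2 j hn he, ← hpj]; linarith)
      refine ⟨h.1, fun h0 => absurd h0 (by omega), fun i hi => ?_⟩
      obtain rfl : i = j := by omega
      exact h.2
  refine ⟨fun j hj => (main j hj).1, fun j hj => (main (j + 1) hj).2.2 j rfl,
    fun hn => (main 0 hn).2.1 rfl⟩

/-! ### Odd (antisymmetric) vectors -/

/-- A sum of an odd function over an antisymmetric vector (`v (rev i) = -v i`) vanishes.
[folklore] -/
theorem sum_eq_zero_of_rev {n : ℕ} {v : Fin n → ℝ} (hv : ∀ i, v (Fin.rev i) = -v i)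
    {g : ℝ → ℝ} (hg : ∀ y, g (-y) = -g y) : ∑ i, g (v i) = 0 := by
  have h : ∑ i, g (v (Fin.revPerm i)) = ∑ i, g (v i) := Equiv.sum_comp Fin.revPerm (fun i => g (v i))
  simp only [Fin.revPerm_apply, hv, hg, Finset.sum_neg_distrib] at h
  linarith

/-- Reflecting an antisymmetric vector does not change sums over it. [folklore] -/
theorem sum_neg_eq_of_rev {n : ℕ} {v : Fin n → ℝ} (hv : ∀ i, v (Fin.rev i) = -v i)
    (g : ℝ → ℝ) : ∑ i, g (-v i) = ∑ i, g (v i) := by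
  have h : ∑ i, g (v (Fin.revPerm i)) = ∑ i, g (v i) := Equiv.sum_comp Fin.revPerm (fun i => g (v i))
  simpa only [Fin.revPerm_apply, hv] using h

/-- The first set of Lieb–Wu equations is reflection-covariant: for antisymmetric `I`, `k`, `Λ`,
the equation for `k_j` implies the one for `k_{N+1-j}` (Goldbaum 2005, §2.1: "because of the
symmetry of the coefficients `I_j` and `J_α`, we can look for symmetric solutions").
[cite: Goldbaum2005, §2.1] -/
theorem liebWu_fst_rev {U : ℝ} {Na N M : ℕ} {I k : Fin N → ℝ} {Λ : Fin M → ℝ}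
    (hI : ∀ j, I (Fin.rev j) = -I j) (hk : ∀ j, k (Fin.rev j) = -k j)
    (hΛ : ∀ β, Λ (Fin.rev β) = -Λ β) {j : Fin N}
    (h : (Na : ℝ) * k j = 2 * π * I j + ∑ β, liebWuTheta U (2 * Real.sin (k j) - 2 * Λ β)) :
    (Na : ℝ) * k (Fin.rev j) =
      2 * π * I (Fin.rev j) + ∑ β, liebWuTheta U (2 * Real.sin (k (Fin.rev j)) - 2 * Λ β) := by
  have hsum : ∑ β, liebWuTheta U (2 * Real.sin (-k j) - 2 * Λ β) =
      -∑ β, liebWuTheta U (2 * Real.sin (k j) - 2 * Λ β) := by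
    rw [← sum_neg_eq_of_rev hΛ (fun y => liebWuTheta U (2 * Real.sin (-k j) - 2 * y)),
      ← Finset.sum_neg_distrib]
    refine Finset.sum_congr rfl fun β _ => ?_
    rw [← liebWuTheta_neg, Real.sin_neg]
    ring_nf
  rw [hk, hI, hsum, mul_neg, h]
  ring

/-- The second set of Lieb–Wu equations is reflection-covariant (as `liebWu_fst_rev`).
[cite: Goldbaum2005, §2.1] -/
theorem liebWu_snd_rev {U : ℝ} {N M : ℕ} {J : Fin M → ℝ} {k : Fin N → ℝ} {Λ : Fin M → ℝ}
    (hJ : ∀ α, J (Fin.rev α) = -J α) (hk : ∀ j, k (Fin.rev j) = -k j)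
    (hΛ : ∀ β, Λ (Fin.rev β) = -Λ β) {α : Fin M}
    (h : ∑ j, liebWuTheta U (2 * Real.sin (k j) - 2 * Λ α) =
      2 * π * J α - ∑ β, liebWuTheta U (Λ α - Λ β)) :
    ∑ j, liebWuTheta U (2 * Real.sin (k j) - 2 * Λ (Fin.rev α)) =
      2 * π * J (Fin.rev α) - ∑ β, liebWuTheta U (Λ (Fin.rev α) - Λ β) := by
  have hl : ∑ j, liebWuTheta U (2 * Real.sin (k j) - 2 * -Λ α) =
      -∑ j, liebWuTheta U (2 * Real.sin (k j) - 2 * Λ α) := by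
    rw [← sum_neg_eq_of_rev hk (fun y => liebWuTheta U (2 * Real.sin y - 2 * -Λ α)),
      ← Finset.sum_neg_distrib]
    refine Finset.sum_congr rfl fun j _ => ?_
    rw [← liebWuTheta_neg, Real.sin_neg]
    ring_nf
  have hr : ∑ β, liebWuTheta U (-Λ α - Λ β) = -∑ β, liebWuTheta U (Λ α - Λ β) := by
    rw [← sum_neg_eq_of_rev hΛ (fun y => liebWuTheta U (-Λ α - y)), ← Finset.sum_neg_distrib]
    refine Finset.sum_congr rfl fun β _ => ?_
    rw [← liebWuTheta_neg]
    ring_nf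
  rw [hΛ, hJ, hl, hr, h]
  ring


/-! ### Symmetric (odd) root vectors built from their positive halves -/

/-- The antisymmetric momentum vector `k = (-p_{2m}, …, -p_0, p_0, …, p_{2m})` on `4m + 2`
indices built from its positive half `p` (Goldbaum's symmetric ansatz `k_j = -k_{N-j+1}`).
[cite: Goldbaum2005, §2.1] -/
def kOfHalf (m : ℕ) (p : Fin (2 * m + 1) → ℝ) (i : Fin (4 * m + 2)) : ℝ :=
  if h : 2 * m + 1 ≤ (i : ℕ) then p ⟨i - (2 * m + 1), by have := i.isLt; omega⟩
  else -p ⟨2 * m - i, by omega⟩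

/-- The antisymmetric spin-rapidity vector `Λ = (-q_{m-1}, …, -q_0, 0, q_0, …, q_{m-1})` on
`2m + 1` indices built from its positive half `q` (Goldbaum's `Λ_α = -Λ_{M-α+1}`, in particular
`Λ_{(M+1)/2} = 0`). [cite: Goldbaum2005, §2.1] -/
def lamOfHalf (m : ℕ) (q : Fin m → ℝ) (α : Fin (2 * m + 1)) : ℝ :=
  if h : m + 1 ≤ (α : ℕ) then q ⟨α - (m + 1), by have := α.isLt; omega⟩
  else if h' : (α : ℕ) = m then 0 else -q ⟨m - 1 - α, by omega⟩

/-- The positive half of `k`: `k_{2m+1+j} = p_j`. [cite: Goldbaum2005, §2.1] -/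
theorem kOfHalf_apply_of_le {m : ℕ} (p : Fin (2 * m + 1) → ℝ) {i : Fin (4 * m + 2)}
    (h : 2 * m + 1 ≤ (i : ℕ)) :
    kOfHalf m p i = p ⟨i - (2 * m + 1), by have := i.isLt; omega⟩ := dif_pos h

/-- The negative half of `k`: `k_i = -p_{2m-i}` for `i ≤ 2m`. [cite: Goldbaum2005, §2.1] -/
theorem kOfHalf_apply_of_lt {m : ℕ} (p : Fin (2 * m + 1) → ℝ) {i : Fin (4 * m + 2)}
    (h : (i : ℕ) < 2 * m + 1) :
    kOfHalf m p i = -p ⟨2 * m - i, by omega⟩ := dif_neg (by omega)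

/-- `k` is antisymmetric: `k_{N+1-j} = -k_j`. [cite: Goldbaum2005, §2.1] -/
theorem kOfHalf_rev {m : ℕ} (p : Fin (2 * m + 1) → ℝ) (i : Fin (4 * m + 2)) :
    kOfHalf m p (Fin.rev i) = -kOfHalf m p i := by
  have hi := i.isLt
  by_cases h : 2 * m + 1 ≤ (i : ℕ)
  · rw [kOfHalf_apply_of_le p h, kOfHalf_apply_of_lt p (by rw [Fin.val_rev]; omega)]
    congr 2
    ext
    simp only [Fin.val_rev]
    omega
  · rw [not_le] at h
    rw [kOfHalf_apply_of_lt p h, kOfHalf_apply_of_le p (by rw [Fin.val_rev]; omega), neg_neg]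
    congr 1
    ext
    simp only [Fin.val_rev]
    omega

/-- The positive half of `Λ`: `Λ_{m+1+a} = q_a`. [cite: Goldbaum2005, §2.1] -/
theorem lamOfHalf_apply_of_le {m : ℕ} (q : Fin m → ℝ) {α : Fin (2 * m + 1)}
    (h : m + 1 ≤ (α : ℕ)) :
    lamOfHalf m q α = q ⟨α - (m + 1), by have := α.isLt; omega⟩ := dif_pos h

/-- The middle rapidity vanishes: `Λ_{(M+1)/2} = 0`. [cite: Goldbaum2005, §2.1] -/
theorem lamOfHalf_apply_mid {m : ℕ} (q : Fin m → ℝ) {α : Fin (2 * m + 1)} (h : (α : ℕ) = m) :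
    lamOfHalf m q α = 0 := by
  rw [lamOfHalf, dif_neg (by omega), dif_pos h]

/-- The negative half of `Λ`: `Λ_α = -q_{m-1-α}` for `α < m`. [cite: Goldbaum2005, §2.1] -/
theorem lamOfHalf_apply_of_lt {m : ℕ} (q : Fin m → ℝ) {α : Fin (2 * m + 1)} (h : (α : ℕ) < m) :
    lamOfHalf m q α = -q ⟨m - 1 - α, by omega⟩ := by
  rw [lamOfHalf, dif_neg (by omega), dif_neg (by omega)]

/-- `Λ` is antisymmetric: `Λ_{M+1-α} = -Λ_α`. [cite: Goldbaum2005, §2.1] -/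
theorem lamOfHalf_rev {m : ℕ} (q : Fin m → ℝ) (α : Fin (2 * m + 1)) :
    lamOfHalf m q (Fin.rev α) = -lamOfHalf m q α := by
  have hα := α.isLt
  rcases Nat.lt_trichotomy (α : ℕ) m with h | h | h
  · rw [lamOfHalf_apply_of_lt q h, lamOfHalf_apply_of_le q (by rw [Fin.val_rev]; omega), neg_neg]
    congr 1
    ext
    simp only [Fin.val_rev]
    omega
  · rw [lamOfHalf_apply_mid q h, lamOfHalf_apply_mid q (by rw [Fin.val_rev]; omega), neg_zero]
  · rw [lamOfHalf_apply_of_le q (α := α) (by omega),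
      lamOfHalf_apply_of_lt q (α := Fin.rev α) (by rw [Fin.val_rev]; omega)]
    congr 2
    ext
    simp only [Fin.val_rev]
    omega

/-- `k` lies in `[-π, π]` when its positive half lies in `[0, π]`. [cite: Goldbaum2005, §2.2] -/
theorem kOfHalf_mem_Icc {m : ℕ} {p : Fin (2 * m + 1) → ℝ} (h0 : ∀ j, 0 ≤ p j)
    (hπ : ∀ j, p j ≤ π) (i : Fin (4 * m + 2)) : kOfHalf m p i ∈ Set.Icc (-π) π := by
  by_cases h : 2 * m + 1 ≤ (i : ℕ)
  · rw [kOfHalf_apply_of_le p h]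
    exact ⟨by linarith [h0 ⟨i - (2 * m + 1), by have := i.isLt; omega⟩, Real.pi_pos], hπ _⟩
  · rw [kOfHalf_apply_of_lt p (by omega)]
    exact ⟨by linarith [hπ ⟨2 * m - i, by omega⟩], by linarith [h0 ⟨2 * m - i, by omega⟩, Real.pi_pos]⟩

/-- A strictly increasing positive half with `p_0 > 0` gives a strictly increasing `k`.
[cite: Goldbaum2005, Theorem 1.1] -/
theorem strictMono_kOfHalf {m : ℕ} {p : Fin (2 * m + 1) → ℝ} (hp : StrictMono p)
    (hp0 : 0 < p ⟨0, by omega⟩) : StrictMono (kOfHalf m p) := by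
  rw [Fin.strictMono_iff_lt_succ]
  intro i
  have hi := i.isLt
  have hpos : ∀ j, 0 < p j := fun j => hp0.trans_le (hp.monotone (Fin.mk_le_mk.mpr (Nat.zero_le _)))
  rcases Nat.lt_trichotomy ((i : ℕ) + 1) (2 * m + 1) with h | h | h
  · rw [kOfHalf_apply_of_lt p (show ((Fin.castSucc i : Fin (4 * m + 2)) : ℕ) < 2 * m + 1 by
        simp; omega), kOfHalf_apply_of_lt p (show ((i.succ : Fin (4 * m + 2)) : ℕ) < 2 * m + 1 by
        simp; omega), neg_lt_neg_iff]
    apply hp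
    rw [Fin.mk_lt_mk]
    simp only [Fin.val_succ, Fin.val_castSucc]
    omega
  · rw [kOfHalf_apply_of_lt p (show ((Fin.castSucc i : Fin (4 * m + 2)) : ℕ) < 2 * m + 1 by
        simp; omega), kOfHalf_apply_of_le p (show 2 * m + 1 ≤ ((i.succ : Fin (4 * m + 2)) : ℕ) by
        simp; omega)]
    exact (neg_neg_of_pos (hpos _)).trans (hpos _)
  · rw [kOfHalf_apply_of_le p (show 2 * m + 1 ≤ ((Fin.castSucc i : Fin (4 * m + 2)) : ℕ) by
        simp; omega), kOfHalf_apply_of_le p (show 2 * m + 1 ≤ ((i.succ : Fin (4 * m + 2)) : ℕ) by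
        simp; omega)]
    apply hp
    rw [Fin.mk_lt_mk]
    simp only [Fin.val_succ, Fin.val_castSucc]
    omega

/-- A strictly increasing positive positive half gives a strictly increasing `Λ`.
[cite: Goldbaum2005, Theorem 1.1] -/
theorem strictMono_lamOfHalf {m : ℕ} {q : Fin m → ℝ} (hq : StrictMono q) (hq0 : ∀ a, 0 < q a) :
    StrictMono (lamOfHalf m q) := by
  rw [Fin.strictMono_iff_lt_succ]
  intro α
  have hα := α.isLt
  have hcs : ((Fin.castSucc α : Fin (2 * m + 1)) : ℕ) = α := by simp
  have hsc : ((α.succ : Fin (2 * m + 1)) : ℕ) = α + 1 := by simp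
  rcases Nat.lt_trichotomy ((α : ℕ) + 1) m with h | h | h
  · rw [lamOfHalf_apply_of_lt q (show ((Fin.castSucc α : Fin (2 * m + 1)) : ℕ) < m by omega),
      lamOfHalf_apply_of_lt q (show ((α.succ : Fin (2 * m + 1)) : ℕ) < m by omega), neg_lt_neg_iff]
    apply hq
    rw [Fin.mk_lt_mk]
    omega
  · rw [lamOfHalf_apply_of_lt q (show ((Fin.castSucc α : Fin (2 * m + 1)) : ℕ) < m by omega),
      lamOfHalf_apply_mid q (show ((α.succ : Fin (2 * m + 1)) : ℕ) = m by omega)]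
    exact neg_neg_of_pos (hq0 _)
  · rcases Nat.lt_or_ge m ((α : ℕ) + 1) |>.resolve_right (by omega) |> Nat.lt_iff_add_one_le.mp
      |> Nat.eq_or_lt_of_le with h' | h'
    · rw [lamOfHalf_apply_mid q (show ((Fin.castSucc α : Fin (2 * m + 1)) : ℕ) = m by omega),
        lamOfHalf_apply_of_le q (show m + 1 ≤ ((α.succ : Fin (2 * m + 1)) : ℕ) by omega)]
      exact hq0 _
    · rw [lamOfHalf_apply_of_le q (show m + 1 ≤ ((Fin.castSucc α : Fin (2 * m + 1)) : ℕ) by omega),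
        lamOfHalf_apply_of_le q (show m + 1 ≤ ((α.succ : Fin (2 * m + 1)) : ℕ) by omega)]
      apply hq
      rw [Fin.mk_lt_mk]
      omega

/-- Strict monotonicity on `Fin m` from consecutive comparisons. [folklore] -/
theorem strictMono_of_apply_lt_apply_succ {m : ℕ} {q : Fin m → ℝ}
    (h : ∀ (a : ℕ) (ha : a + 1 < m), q ⟨a, by omega⟩ < q ⟨a + 1, ha⟩) : StrictMono q := by
  cases m with
  | zero => exact fun a => a.elim0
  | succ n =>
    rw [Fin.strictMono_iff_lt_succ]
    intro i
    exact h i.val (by simp [i.isLt])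

/-! ### Goldbaum's map -/

variable (U : ℝ) (m : ℕ)

/-- The `j`-th positive momentum read off a point of the box (`0` out of range). [folklore] -/
def pAt (x : Fin (2 * m + 1) ⊕ Fin m → ℝ) (j : ℕ) : ℝ :=
  if h : j < 2 * m + 1 then x (Sum.inl ⟨j, h⟩) else 0

/-- The `a`-th positive spin rapidity read off a point of the box (`0` out of range).
[folklore] -/
def qAt (x : Fin (2 * m + 1) ⊕ Fin m → ℝ) (a : ℕ) : ℝ :=
  if h : a < m then x (Sum.inr ⟨a, h⟩) else 0

/-- Goldbaum's unclamped momentum update `k'_j = (2π I_j + Σ_β θ(2 sin k_j - 2Λ_β))/N_a` for the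
`j`-th positive momentum (`I = j + 1/2`, `j = 0, …, 2m`) at half filling `N = N_a = 4m + 2`.
[cite: Goldbaum2005, §2.1] -/
noncomputable def kStep (x : Fin (2 * m + 1) ⊕ Fin m → ℝ) (j : ℕ) : ℝ :=
  (2 * π * (j + 1 / 2) +
      ∑ β, liebWuTheta U (2 * Real.sin (pAt m x j) - 2 * lamOfHalf m (fun a => x (Sum.inr a)) β)) /
    (4 * m + 2)

/-- The unclamped rapidity update for the `a`-th positive rapidity (`J = a + 1`): the relaxation
`Λ_α + (2π J_α - Σ_β θ(Λ_α - Λ_β) - Σ_j θ(2 sin k_j - 2Λ_α))` of the second Lieb–Wu equation,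
whose fixed points are exactly its solutions (Goldbaum instead solves the equation for `Λ_α`
implicitly, eq. (2.1); the fixed points are the same). [cite: Goldbaum2005, §2.1, eq. (2.1)] -/
noncomputable def lamStep (x : Fin (2 * m + 1) ⊕ Fin m → ℝ) (a : ℕ) : ℝ :=
  qAt m x a + (2 * π * (a + 1) - ∑ β, liebWuTheta U (qAt m x a - lamOfHalf m (fun a => x (Sum.inr a)) β) -
    ∑ i, liebWuTheta U (2 * Real.sin (kOfHalf m (fun j => x (Sum.inl j)) i) - 2 * qAt m x a))

/-- The a-priori bound `C = 1 + (U/4) tan((4m+1)π/(8m+4))` on the positive spin rapidities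
(playing the role of Goldbaum's constant `C_{N,U}`, §2.1: at `Λ_α = C` the left side of the second
Lieb–Wu equation dominates its right side, `lamStep_cap`). [cite: Goldbaum2005, §2.1] -/
noncomputable def lamBound : ℝ := 1 + U / 4 * Real.tan ((4 * m + 1) * π / (8 * m + 4))

/-- **Goldbaum's map** on the box `[0, π]^{2m+1} × [0, C_{N,U}]^m` of positive halves of
symmetric roots: clamped running maxima of the unclamped updates `kStep`, `lamStep`. Its fixed
points are the ordered solutions of the Lieb–Wu equations. [cite: Goldbaum2005, §§2.1–2.3] -/
noncomputable def goldbaumMap (x : Fin (2 * m + 1) ⊕ Fin m → ℝ) : Fin (2 * m + 1) ⊕ Fin m → ℝ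
  | Sum.inl j => runMax π (kStep U m x) j
  | Sum.inr a => runMax (lamBound U m) (lamStep U m x) a

/-- The upper corner `(π, …, π, C, …, C)` of Goldbaum's box `Ω`. [cite: Goldbaum2005, Lemma 2.1] -/
noncomputable def boxTop : Fin (2 * m + 1) ⊕ Fin m → ℝ
  | Sum.inl _ => π
  | Sum.inr _ => lamBound U m

variable {U m}

/-- The angle `(4m+1)π/(8m+4)` defining `C_{N,U}` is below `π/2`. [folklore] -/
theorem lamBound_angle_lt (m : ℕ) : (4 * m + 1 : ℝ) * π / (8 * m + 4) < π / 2 := by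
  rw [div_lt_div_iff₀ (by positivity) (by positivity)]
  nlinarith [Real.pi_pos]

/-- The angle `(4m+1)π/(8m+4)` defining `C_{N,U}` is nonnegative. [folklore] -/
theorem lamBound_angle_nonneg (m : ℕ) : 0 ≤ (4 * m + 1 : ℝ) * π / (8 * m + 4) := by
  positivity

/-- `C_{N,U} ≥ 1` for `U ≥ 0`. [cite: Goldbaum2005, §2.1] -/
theorem one_le_lamBound (hU : 0 ≤ U) (m : ℕ) : 1 ≤ lamBound U m := by
  have := Real.tan_nonneg_of_nonneg_of_le_pi_div_two (lamBound_angle_nonneg m)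
    (lamBound_angle_lt m).le
  unfold lamBound
  nlinarith

/-- `C_{N,U} > 0` for `U ≥ 0`. [cite: Goldbaum2005, §2.1] -/
theorem lamBound_pos (hU : 0 ≤ U) (m : ℕ) : 0 < lamBound U m :=
  one_pos.trans_le (one_le_lamBound hU m)

/-- `θ(p) = -2 arctan(2p/U)` is continuous. [cite: LiebWuPhysicaA2003, §3] -/
theorem continuous_liebWuTheta (U : ℝ) : Continuous (liebWuTheta U) := by
  unfold liebWuTheta
  fun_prop

/-- Coordinates of the box depend continuously on the point. [folklore] -/
theorem continuous_pAt (m j : ℕ) : Continuous fun x : Fin (2 * m + 1) ⊕ Fin m → ℝ => pAt m x j := by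
  unfold pAt
  split_ifs
  · exact continuous_apply _
  · exact continuous_const

/-- Coordinates of the box depend continuously on the point. [folklore] -/
theorem continuous_qAt (m a : ℕ) : Continuous fun x : Fin (2 * m + 1) ⊕ Fin m → ℝ => qAt m x a := by
  unfold qAt
  split_ifs
  · exact continuous_apply _
  · exact continuous_const

/-- The symmetric extension `Λ` depends continuously on the point of the box. [folklore] -/
theorem continuous_lamOfHalf_apply (m : ℕ) (β : Fin (2 * m + 1)) :
    Continuous fun x : Fin (2 * m + 1) ⊕ Fin m → ℝ => lamOfHalf m (fun a => x (Sum.inr a)) β := by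
  unfold lamOfHalf
  split_ifs
  · exact continuous_apply _
  · exact continuous_const
  · exact (continuous_apply _).neg

/-- The symmetric extension `k` depends continuously on the point of the box. [folklore] -/
theorem continuous_kOfHalf_apply (m : ℕ) (i : Fin (4 * m + 2)) :
    Continuous fun x : Fin (2 * m + 1) ⊕ Fin m → ℝ => kOfHalf m (fun j => x (Sum.inl j)) i := by
  unfold kOfHalf
  split_ifs
  · exact continuous_apply _
  · exact (continuous_apply _).neg

/-- The momentum update is continuous. [cite: Goldbaum2005, §2.2] -/
theorem continuous_kStep (U : ℝ) (m j : ℕ) :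
    Continuous fun x : Fin (2 * m + 1) ⊕ Fin m → ℝ => kStep U m x j := by
  unfold kStep
  refine Continuous.div_const (continuous_const.add (continuous_finsetSum _ fun β _ => ?_)) _
  exact (continuous_liebWuTheta U).comp
    ((continuous_const.mul (Real.continuous_sin.comp (continuous_pAt m j))).sub
      (continuous_const.mul (continuous_lamOfHalf_apply m β)))

/-- The rapidity update is continuous. [cite: Goldbaum2005, §2.2] -/
theorem continuous_lamStep (U : ℝ) (m a : ℕ) :
    Continuous fun x : Fin (2 * m + 1) ⊕ Fin m → ℝ => lamStep U m x a := by
  unfold lamStep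
  refine (continuous_qAt m a).add (Continuous.sub (continuous_const.sub
    (continuous_finsetSum _ fun β _ => ?_)) (continuous_finsetSum _ fun i _ => ?_))
  · exact (continuous_liebWuTheta U).comp ((continuous_qAt m a).sub (continuous_lamOfHalf_apply m β))
  · exact (continuous_liebWuTheta U).comp
      ((continuous_const.mul (Real.continuous_sin.comp (continuous_kOfHalf_apply m i))).sub
        (continuous_const.mul (continuous_qAt m a)))

/-- Goldbaum's map is continuous. [cite: Goldbaum2005, §2.2] -/
theorem continuous_goldbaumMap (U : ℝ) (m : ℕ) : Continuous (goldbaumMap U m) := by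
  refine continuous_pi ?_
  rintro (j | a)
  · exact continuous_runMax π (fun j => continuous_kStep U m j) j
  · exact continuous_runMax _ (fun a => continuous_lamStep U m a) a

/-- Goldbaum's map sends everything into the box `Ω = [0, π]^{2m+1} × [0, C]^m`.
[cite: Goldbaum2005, Lemma 2.1] -/
theorem goldbaumMap_mem_box (hU : 0 ≤ U) (m : ℕ) (x : Fin (2 * m + 1) ⊕ Fin m → ℝ) :
    0 ≤ goldbaumMap U m x ∧ goldbaumMap U m x ≤ boxTop U m := by
  constructor
  · rintro (j | a)
    · exact runMax_nonneg Real.pi_pos.le _ _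
    · exact runMax_nonneg (lamBound_pos hU m).le _ _
  · rintro (j | a)
    · exact runMax_le _ _ _
    · exact runMax_le _ _ _

/-- **The a-priori bound on the rapidities** (Goldbaum's `Λ'_α ≤ C_{N,U}`, §2.1): at
`Λ = C = 1 + (U/4) tan((4m+1)π/(8m+4))` the left side `Σ_j θ(2 sin k_j - 2Λ)` of the second
Lieb–Wu equation is at least `(4m+2) · 2 · (4m+1)π/(8m+4) = (4m+1)π` (`sin ≤ 1`, `arctan`
monotone), which dominates its right side `2π J_α - Σ_β θ(Λ - Λ_β) ≤ 2πm + (2m+1)π`.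
[cite: Goldbaum2005, §2.1] -/
theorem lamStep_cap (hU : 0 < U) {m : ℕ} (p : Fin (2 * m + 1) → ℝ) (q : Fin m → ℝ) {a : ℕ}
    (ha : a < m) :
    2 * π * (a + 1) - ∑ β, liebWuTheta U (lamBound U m - lamOfHalf m q β) ≤
      ∑ i, liebWuTheta U (2 * Real.sin (kOfHalf m p i) - 2 * lamBound U m) := by
  set C := lamBound U m with hC
  set φ : ℝ := (4 * m + 1 : ℝ) * π / (8 * m + 4) with hφ
  have hφlt := lamBound_angle_lt m
  have hφ0 := lamBound_angle_nonneg m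
  -- right side of the second equation
  have h1 : -∑ β, liebWuTheta U (C - lamOfHalf m q β) ≤ (2 * m + 1) * π := by
    rw [← Finset.sum_neg_distrib]
    calc ∑ β, -liebWuTheta U (C - lamOfHalf m q β) ≤ ∑ _β : Fin (2 * m + 1), π :=
          Finset.sum_le_sum fun β _ => by
            have := abs_liebWuTheta_lt U (C - lamOfHalf m q β)
            rw [abs_lt] at this
            linarith
      _ = (2 * m + 1) * π := by simp
  have h2 : 2 * π * (a + 1) ≤ 2 * π * m := by
    have : (a : ℝ) + 1 ≤ m := by exact_mod_cast ha
    nlinarith [Real.pi_pos]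
  -- left side of the second equation
  have h3 : ∀ i, 2 * φ ≤ liebWuTheta U (2 * Real.sin (kOfHalf m p i) - 2 * C) := by
    intro i
    have hs := Real.sin_le_one (kOfHalf m p i)
    have htan : Real.arctan (2 * (2 * 1 - 2 * C) / U) = -φ := by
      have hCφ : C = 1 + U / 4 * Real.tan φ := by rw [hC, hφ]; rfl
      have : 2 * (2 * 1 - 2 * C) / U = -Real.tan φ := by
        rw [hCφ]
        field_simp
        ring
      rw [this, Real.arctan_neg, Real.arctan_tan (by linarith) hφlt]
    have hmono : Real.arctan (2 * (2 * Real.sin (kOfHalf m p i) - 2 * C) / U) ≤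
        Real.arctan (2 * (2 * 1 - 2 * C) / U) := by
      apply Real.arctan_mono
      gcongr
    rw [liebWuTheta]
    linarith
  have h4 : (4 * m + 1 : ℝ) * π ≤ ∑ i, liebWuTheta U (2 * Real.sin (kOfHalf m p i) - 2 * C) := by
    calc (4 * m + 1 : ℝ) * π = ∑ _i : Fin (4 * m + 2), 2 * φ := by
          simp only [Finset.sum_const, Finset.card_univ, Fintype.card_fin, nsmul_eq_mul, hφ]
          push_cast
          field_simp
          ring
      _ ≤ _ := Finset.sum_le_sum fun i _ => h3 i
  linarith

/-! ### Goldbaum's existence theorem at half filling -/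

/-- **F1 discharged: Goldbaum's existence theorem (half-filled case).** For every `U > 0` and
every `m`, the Lieb–Wu equations on the ring of `N_a = 4m + 2` sites with `N = 4m + 2` electrons,
`M = 2m + 1`, and the ground-state quantum numbers have a real solution with
`-π ≤ k_1 < ⋯ < k_N ≤ π` and `Λ_1 < ⋯ < Λ_M`. Proof after Goldbaum, CMP 258 (2005) 317, §2:
look for symmetric roots `k_j = -k_{N+1-j}`, `Λ_α = -Λ_{M+1-α}` (§2.1); on the box
`Ω = [0, π]^{2m+1} × [0, C_{N,U}]^m` of their positive halves consider the continuous self-map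
whose momentum components are the clamped running maxima of
`k'_j = (2π I_j + Σ_β θ(2 sin k_j - 2Λ_β))/N_a` and whose rapidity components are the clamped
running maxima of the relaxed second equation (Goldbaum solves it implicitly instead, eq. (2.1));
Brouwer's fixed point theorem (§2.2, here `exists_fixedPoint_of_mapsTo_box` from
`Literature.Topology.Euclidean.Brouwer.exists_fixedPoint_closedBall`) gives a fixed point, at which the clamps are inactive
and the coordinates strictly increase (§2.3, `runMax_fixedPoint`), so that the symmetric
extension solves the Lieb–Wu equations (reflection covariance, `liebWu_fst_rev`,
`liebWu_snd_rev`). [cite: Goldbaum2005, Theorem 1.1, §§2.1–2.3] -/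
theorem goldbaum_liebWuGroundRoots_exists_holds' (U : ℝ) (hU : 0 < U) (m : ℕ) :
    ∃ (k : Fin (4 * m + 2) → ℝ) (Λ : Fin (2 * m + 1) → ℝ), IsLiebWuGroundRoots U m k Λ := by
  -- Brouwer
  have hbox : (0 : Fin (2 * m + 1) ⊕ Fin m → ℝ) ≤ boxTop U m := by
    rintro (j | a)
    · exact Real.pi_pos.le
    · exact (lamBound_pos hU.le m).le
  obtain ⟨x, hx0, hxb, hfix⟩ := exists_fixedPoint_of_mapsTo_box hbox (continuous_goldbaumMap U m)
    (fun x _ _ => goldbaumMap_mem_box hU.le m x)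
  set p : Fin (2 * m + 1) → ℝ := fun j => x (Sum.inl j) with hp
  set q : Fin m → ℝ := fun a => x (Sum.inr a) with hq
  set k := kOfHalf m p with hk
  set Λ := lamOfHalf m q with hΛ
  have hkrev : ∀ i, k (Fin.rev i) = -k i := kOfHalf_rev p
  have hΛrev : ∀ β, Λ (Fin.rev β) = -Λ β := lamOfHalf_rev q
  have hNa : ((4 * m + 2 : ℕ) : ℝ) = 4 * m + 2 := by push_cast; ring
  -- values of the box coordinates
  have hpAt : ∀ {j : ℕ} (hj : j < 2 * m + 1), pAt m x j = p ⟨j, hj⟩ := fun hj => dif_pos hj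
  have hqAt : ∀ {a : ℕ} (ha : a < m), qAt m x a = q ⟨a, ha⟩ := fun ha => dif_pos ha
  -- sums vanishing by antisymmetry
  have hT0 : ∑ β, liebWuTheta U (2 * 0 - 2 * Λ β) = 0 :=
    sum_eq_zero_of_rev hΛrev (g := fun y => liebWuTheta U (2 * 0 - 2 * y)) fun y => by
      rw [← liebWuTheta_neg]; ring_nf
  have hG0 : ∑ β, liebWuTheta U (0 - Λ β) = 0 :=
    sum_eq_zero_of_rev hΛrev (g := fun y => liebWuTheta U (0 - y)) fun y => by
      rw [← liebWuTheta_neg]; ring_nf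
  have hL0 : ∑ i, liebWuTheta U (2 * Real.sin (k i) - 2 * 0) = 0 :=
    sum_eq_zero_of_rev hkrev (g := fun y => liebWuTheta U (2 * Real.sin y - 2 * 0)) fun y => by
      rw [← liebWuTheta_neg, Real.sin_neg]; ring_nf
  -- fixed-point analysis of the momenta
  obtain ⟨hpc, hpmono, hp0⟩ := runMax_fixedPoint (top := π) (δ := 2 * π / (4 * m + 2))
    (c := kStep U m x) (p := pAt m x) (n := 2 * m + 1) Real.pi_pos (by positivity)
    (fun j hj => by
      rw [hpAt hj]
      have := congr_fun hfix (Sum.inl ⟨j, hj⟩)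
      exact this.symm)
    (fun j hj hjπ => by
      have hj' : (j : ℝ) ≤ 2 * m := by exact_mod_cast Nat.lt_succ_iff.mp hj
      rw [kStep, hjπ, Real.sin_pi, hT0, add_zero, div_le_iff₀ (by positivity)]
      nlinarith [Real.pi_pos])
    (fun j hj he => by
      rw [kStep, kStep, he]
      push_cast
      field_simp
      ring)
    (fun _ h0 => by
      rw [kStep, h0, Real.sin_zero, hT0, add_zero]
      positivity)
  -- fixed-point analysis of the rapidities
  obtain ⟨hqc, hqmono, hq0⟩ := runMax_fixedPoint (top := lamBound U m) (δ := 2 * π)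
    (c := lamStep U m x) (p := qAt m x) (n := m) (lamBound_pos hU.le m) Real.two_pi_pos
    (fun a ha => by
      rw [hqAt ha]
      have := congr_fun hfix (Sum.inr ⟨a, ha⟩)
      exact this.symm)
    (fun a ha haC => by
      rw [lamStep, haC]
      have := lamStep_cap hU p q ha
      linarith)
    (fun a ha he => by
      rw [lamStep, lamStep, he]
      push_cast
      ring)
    (fun _ h0 => by
      rw [lamStep, h0, hG0, hL0, Nat.cast_zero]
      linarith [Real.pi_pos])
  -- monotonicity
  have hpmono' : StrictMono p := by
    refine strictMono_of_apply_lt_apply_succ fun j hj => ?_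
    have h := hpmono j hj
    rwa [hpAt (by omega), hpAt hj] at h
  have hp0' : 0 < p ⟨0, by omega⟩ := by
    have h := hp0 (by omega)
    rwa [hpAt (by omega)] at h
  have hqmono' : StrictMono q := by
    refine strictMono_of_apply_lt_apply_succ fun a ha => ?_
    have h := hqmono a ha
    rwa [hqAt (by omega), hqAt ha] at h
  have hq0' : ∀ a, 0 < q a := by
    intro a
    have hm : 0 < m := by have := a.isLt; omega
    have h := hq0 hm
    rw [hqAt hm] at h
    exact h.trans_le (hqmono'.monotone (Fin.mk_le_mk.mpr (Nat.zero_le _)))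
  refine ⟨k, Λ, ⟨?_, ?_⟩, strictMono_kOfHalf hpmono' hp0', strictMono_lamOfHalf hqmono' hq0',
    kOfHalf_mem_Icc (fun j => hx0 (Sum.inl j)) (fun j => hxb (Sum.inl j))⟩
  · -- first Lieb–Wu equations
    have hIrev : ∀ j : Fin (4 * m + 2), liebWuGroundNumbers (4 * m + 2) (Fin.rev j) =
        -liebWuGroundNumbers (4 * m + 2) j := liebWuGroundNumbers_rev
    have high : ∀ i : Fin (4 * m + 2), 2 * m + 1 ≤ (i : ℕ) →
        ((4 * m + 2 : ℕ) : ℝ) * k i = 2 * π * liebWuGroundNumbers (4 * m + 2) i +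
          ∑ β, liebWuTheta U (2 * Real.sin (k i) - 2 * Λ β) := by
      intro i hi
      have hi' := i.isLt
      have hj : (i : ℕ) - (2 * m + 1) < 2 * m + 1 := by omega
      have hki : k i = pAt m x (i - (2 * m + 1)) := by
        rw [hk, kOfHalf_apply_of_le p hi, hpAt hj]
      have hc := hpc _ hj
      rw [kStep, eq_div_iff (by positivity)] at hc
      have hI : liebWuGroundNumbers (4 * m + 2) i = ((i : ℕ) - (2 * m + 1) : ℕ) + 1 / 2 := by
        rw [liebWuGroundNumbers]
        push_cast [Nat.cast_sub hi]
        ring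
      rw [hki, hNa, hI, mul_comm, hc]
    intro i
    by_cases hi : 2 * m + 1 ≤ (i : ℕ)
    · exact high i hi
    · have h := liebWu_fst_rev (U := U) (Na := 4 * m + 2) hIrev hkrev hΛrev
        (high (Fin.rev i) (by rw [Fin.val_rev]; omega))
      simpa only [Fin.rev_rev] using h
  · -- second Lieb–Wu equations
    have hJrev : ∀ α : Fin (2 * m + 1), liebWuGroundNumbers (2 * m + 1) (Fin.rev α) =
        -liebWuGroundNumbers (2 * m + 1) α := liebWuGroundNumbers_rev
    have high : ∀ α : Fin (2 * m + 1), m + 1 ≤ (α : ℕ) →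
        ∑ j, liebWuTheta U (2 * Real.sin (k j) - 2 * Λ α) =
          2 * π * liebWuGroundNumbers (2 * m + 1) α - ∑ β, liebWuTheta U (Λ α - Λ β) := by
      intro α hα
      have hα' := α.isLt
      have ha : (α : ℕ) - (m + 1) < m := by omega
      have hΛα : Λ α = qAt m x (α - (m + 1)) := by
        rw [hΛ, lamOfHalf_apply_of_le q hα, hqAt ha]
      have hc := hqc _ ha
      rw [lamStep] at hc
      have hJ : liebWuGroundNumbers (2 * m + 1) α = ((α : ℕ) - (m + 1) : ℕ) + 1 := by
        rw [liebWuGroundNumbers]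
        push_cast [Nat.cast_sub hα]
        ring
      rw [hΛα, hJ]
      linarith
    intro α
    rcases Nat.lt_trichotomy (α : ℕ) m with hα | hα | hα
    · have h := liebWu_snd_rev (U := U) hJrev hkrev hΛrev
        (high (Fin.rev α) (by rw [Fin.val_rev]; omega))
      simpa only [Fin.rev_rev] using h
    · have hΛα : Λ α = 0 := by rw [hΛ, lamOfHalf_apply_mid q hα]
      have hJ : liebWuGroundNumbers (2 * m + 1) α = 0 := by
        rw [liebWuGroundNumbers, hα]
        push_cast
        ring
      rw [hΛα, hJ, hG0]
      simpa using hL0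
    · exact high α (by omega)

/-- **F1 (`goldbaum_liebWuGroundRoots_exists`) holds**: Goldbaum's existence theorem for the
Lieb–Wu equations at half filling, `N = N_a = 4m + 2`, `M = 2m + 1`, with the ground-state
quantum numbers. [cite: Goldbaum2005, Theorem 1.1] -/
theorem _root_.Literature.MathematicalPhysics.QuantumLattice.goldbaum_liebWuGroundRoots_exists_holds :
    goldbaum_liebWuGroundRoots_exists := fun U hU m =>
  goldbaum_liebWuGroundRoots_exists_holds' U hU m

end LiebWuGoldbaum

end Literature.MathematicalPhysics.QuantumLattice
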